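import Summits.CriticalPhenomena.PercolationContinuityZ3.Theorems.PercNearOneGluingNoHeavyPcintBFibBip
import Summits.CriticalPhenomena.PercolationContinuityZ3.Theorems.PercNearOneGluingNoHeavyPcintUFibZ6
import HarnessLib

/-!
# PCINT lane, T-fibre route PHASE 3, instance `d = 6`: `p_c^bond(ℤ^6) ≤ 0.1913` via `𝕋 × K_{6,6}`

Cell `prim-pcint`, seat `prim-pcint-1` (gen 13); memo `run/shared/lean/prim/pcint/T-FIBRE-ROUTE.md` (PHASE 3).

BOND percolation: `ℤ^6` covers `𝕋 × K_{6,6}` (`UFib.multiLift_proj6`, the PHASE-2 covering, fibre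
`K_{6,6} = Cay(ℤ_{12}, odd)` = `UFib.bipGraph evens12`), so `p_c^bond(ℤ^6) ≤ p_c^bond(𝕋 × K_{6,6})` (Lyons–Peres
Thm. 6.47, bond version `LyonsPeres647Multi.criticalProb_le_of_multiLift`).  The bond T-fibre comparison
(`BFib.criticalProb_lfib_bip_le`: 𝕋-bond at `s = 0.3473 > 2 sin(π/18)` versus the bond fibre process with breadth-first usable
sets of depth `4`, chain-binomial size law, kernel-checked table `BFib.checkBond 6 4 (1913/10⁴) (3473/10⁴)`) gives
`p_c^bond(𝕋 × K_{6,6}) ≤ 0.1913`, hence **`BFib.criticalProb_Z6_le_1913` : `p_c^bond(ℤ^6) ≤ 0.1913`** (print: GPS 2026 Table 1,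
`0.1922`) and the monotone-in-`d` version.
-/

noncomputable section

namespace Summit.CriticalPhenomena.PercolationContinuityZ3.Theorems.Pcint

namespace BFib

open Finset AdaptDom UFib Literature.Probability.Percolation Literature.Probability.LatticeModels LyonsPeres647Multi

/-- **The bond table of `K_{6,6}`, depth `4`, at `p = 0.1913`, `s = 0.3473`**, checked by the kernel in exact rational
arithmetic. -/
theorem checkBond_6 : checkBond 6 4 (((1913 : ℕ) : ℚ) / 10000) (3473 / 10000) = true := by decide +kernel

/-- **`p_c^bond(𝕋 × K_{6,6}) ≤ 0.1913`.** -/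
theorem criticalProb_lfib6_le :
    criticalProb (lfib (bipGraph evens12)) ((0 : Site 2), (0 : ZMod 12)) ≤ (1913 : ℝ) / 10000 := by
  have h := criticalProb_lfib_bip_le evens12 card_evens12 card_evens12_compl 0 zero_mem_evens12.1 1 zero_mem_evens12.2
    4 1913 (by norm_num) (by norm_num) checkBond_6
  simpa using h

/-- **`p_c^bond(ℤ^6) ≤ p_c^bond(𝕋 × K_{6,6})`** (bond covering theorem). [cite: LyonsPeres2016, §6.9 Thm. 6.47] -/
theorem criticalProb_Z6_le_lfib :
    criticalProb (zdGraph 6) (0 : Site 6) ≤ criticalProb (lfib (bipGraph evens12)) ((0 : Site 2), (0 : ZMod 12)) := by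
  have h0 : (((![(0 : Site 6) 0 + (0 : Site 6) 2, (0 : Site 6) 1 - (0 : Site 6) 2] : Site 2), (((0 : Site 6) 3 : ℤ) : ZMod 12) + 3 * (((0 : Site 6) 4 : ℤ) : ZMod 12) + 5 * (((0 : Site 6) 5 : ℤ) : ZMod 12)) : Site 2 × ZMod 12) = ((0 : Site 2), (0 : ZMod 12)) := by
    simp only [Prod.mk.injEq]
    refine ⟨?_, by simp⟩
    ext i; fin_cases i <;> simp
  refine le_of_forall_gt_imp_ge_of_dense fun t ht => ?_
  by_cases ht1 : t ≤ 1
  · have ht0 : 0 ≤ t := (criticalProb_mem_Icc (lfib (bipGraph evens12)) ((0 : Site 2), (0 : ZMod 12))).1.trans ht.le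
    exact criticalProb_le_of_multiLift (zdGraph 6) (lfib (bipGraph evens12)) _ 1 multiLift_proj6 0 ⟨t, ht0, ht1⟩
      (by rw [h0, StarCoins.coe_orParam]; simpa using ht)
  · exact (criticalProb_mem_Icc _ _).2.trans (le_of_not_ge ht1)

/-- **`p_c^bond(ℤ^6) ≤ 0.1913`** (bond T-fibre comparison with complete bipartite fibres `K_{6,6}`; print 0.1922). -/
theorem criticalProb_Z6_le_1913 : criticalProb (zdGraph 6) (0 : Site 6) ≤ 0.1913 :=
  criticalProb_Z6_le_lfib.trans (criticalProb_lfib6_le.trans (by norm_num))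

/-- **`p_c^bond(ℤ^d) ≤ 0.1913` for every `d ≥ 6`.** -/
theorem criticalProb_zd_le_1913 {d : ℕ} (hd : 6 ≤ d) : criticalProb (zdGraph d) (0 : Site d) ≤ 0.1913 :=
  (AxisGrouping.criticalProb_zd_anti hd).trans criticalProb_Z6_le_1913

end BFib

end Summit.CriticalPhenomena.PercolationContinuityZ3.Theorems.Pcint

end
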